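import Mathlib.Analysis.SpecialFunctions.Exponential
import Mathlib.Analysis.Calculus.FDeriv.Symmetric
import Mathlib.Analysis.Calculus.Deriv.Mul
import Mathlib.Analysis.Calculus.Deriv.Prod
import Mathlib.Analysis.Calculus.Deriv.Comp
import Mathlib.Analysis.Calculus.MeanValue
import Mathlib.Analysis.Calculus.ContDiff.RCLike
import Mathlib.Analysis.ODE.Gronwall
import Mathlib.Topology.Algebra.Module.Complement
import Literature.Analysis.Calculus.SmoothAlongExp
import HarnessLib

/-!
# Exponential coordinates along an `Ad`-stable subspace of a Banach algebra

Topic `Analysis/Calculus`; namespace `Literature.Analysis.Calculus`. Let `𝔸` be a real Banach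
algebra, `exp : 𝔸 → 𝔸` its exponential, `log = localLog` the smooth local inverse of `exp` at `0`
(`SmoothAlongExp`), and `𝔤 ≤ 𝔸` a complemented closed real subspace (e.g. any subspace when `𝔸`
is finite-dimensional) which is stable under `Ad (exp c) : Z ↦ exp(c) Z exp(-c)` for every
`c ∈ 𝔤` — for instance the Lie algebra `𝔤` of a linear real group `H ≤ GL_N(A)` in the sense of
`Literature.NumberTheory.Automorphic.RealMatrixGroup` (`exp (t X) ∈ H` for `X ∈ 𝔤`, `𝔤`
`Ad H`-stable), which need not be all of `Lie(H)`. This file PROVES the two analytic facts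
behind "the subgroup generated by `exp 𝔤` is a Lie subgroup with Lie algebra `𝔤`, charted by
`exp`" that the automorphic calculus needs in order to re-centre exponential charts
(`isArchSmooth_lieDeriv`: Lie derivatives of functions smooth along `g · exp 𝔤` are again smooth):

* `exp_neg_mul_fderiv_exp_mem` — the trivialised differential of `exp` preserves `𝔤`:
  `exp(-c) · D exp(c)[Z] ∈ 𝔤` for `c, Z ∈ 𝔤` (classically `= ∑ₘ (-1)^m (ad c)^m Z / (m+1)!`;
  here: `F(s) = exp(-sc) ∂_ε|₀ exp(s(c + εZ))` has `F' = Ad(exp(-sc)) Z ∈ 𝔤`, `F(0) = 0`, by the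
  symmetry of second derivatives, so `F(1) ∈ 𝔤`);
* `exists_isOpen_forall_localLog_mem` — there is an open neighbourhood `V ∋ 1` such that every
  `C¹` path `γ : [0, 1] → V`, `γ(0) = 1`, with bounded logarithmic derivative `γ⁻¹γ' = ξ` valued
  in `𝔤` has `log γ(s) ∈ 𝔤` (`a = log ∘ γ` solves `exp(-a) D exp(a)[a'] = ξ`; splitting
  `a = q a + b` along a retraction `q` onto `𝔤`, the first result and the Lipschitz continuity of
  `x ↦ exp(-x) D exp(x)` give `‖b'‖ ≤ K‖b‖`, `b(0) = 0`, so `b = 0` by Grönwall).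

Applied to `γ(s) = exp(-sY₀) exp(sY) exp(stX)` this yields `log (exp(-Y₀) exp(Y) exp(tX)) ∈ 𝔤`
for `(Y, t)` near `(Y₀, 0)` without any Baker–Campbell–Hausdorff series. Also: `contDiff_exp`,
`exp_neg_mul_exp`, `fderiv_exp_zero`, `eventually_differentiableAt_localLog`. The left-inverse
property `∀ᶠ x in 𝓝 0, localLog (exp x) = x` is Mathlib's
`HasStrictFDerivAt.eventually_left_inverse`: the term `HasStrictFDerivAt.eventually_left_inverse _`
proves it as stated (`localLog` is by definition a `HasStrictFDerivAt.localInverse` of `exp` at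
`0`), so it is not restated here.

Mathlib has `exp`, its analyticity and derivative at `0`, the inverse function theorem, the
symmetry of second derivatives and Grönwall's inequality, but no Lie-group/Lie-algebra
correspondence for closed or virtual subgroups (`lean search 'Campbell|lieSubgroup|exp.*log.*mem'`).
Folklore: Hilgert–Neeb, *Structure and Geometry of Lie Groups* (2012), §9.2–9.4 (derivative of
`exp`, integral subgroups); Hall, *Lie Groups, Lie Algebras, and Representations*, 2nd ed.
(2015), Thm. 5.3 and Thm. 5.20; Knapp, *Lie Groups Beyond an Introduction* (2002), 0.§2–§3,
I.§10.
-/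

noncomputable section

open NormedSpace Filter Set
open scoped Topology ContDiff NNReal

namespace Literature.Analysis.Calculus

variable {𝔸 : Type*} [NormedRing 𝔸] [NormedAlgebra ℝ 𝔸] [CompleteSpace 𝔸]

/-! ### Preliminaries on `exp` and `localLog` -/

/-- `exp : 𝔸 → 𝔸` is `C^m` for every `m`. [folklore] -/
theorem contDiff_exp {m : WithTop ℕ∞} : ContDiff ℝ m (exp : 𝔸 → 𝔸) :=
  contDiff_iff_contDiffAt.2 fun x => contDiffAt_exp x

/-- `exp (-x) * exp x = 1` in a real Banach algebra. [folklore] -/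
theorem exp_neg_mul_exp (x : 𝔸) : exp (-x) * exp x = 1 := by
  have h := exp_add_of_commute_of_mem_ball (𝕂 := ℝ) ((Commute.refl x).neg_left)
    (by simp [expSeries_radius_eq_top]) (by simp [expSeries_radius_eq_top])
  rw [neg_add_cancel, exp_zero] at h
  exact h.symm

/-- `exp x * exp (-x) = 1` in a real Banach algebra. [folklore] -/
theorem exp_mul_exp_neg (x : 𝔸) : exp x * exp (-x) = 1 := by
  simpa using exp_neg_mul_exp (-x)

/-- `fderiv exp 0 = id`. [folklore] -/
theorem fderiv_exp_zero : fderiv ℝ (exp : 𝔸 → 𝔸) 0 = ContinuousLinearMap.id ℝ 𝔸 := by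
  rw [(hasFDerivAt_exp_zero (𝕂 := ℝ) (𝔸 := 𝔸)).fderiv]
  rfl

/-- `localLog` is differentiable at every point near `1`. [folklore] -/
theorem eventually_differentiableAt_localLog :
    ∀ᶠ y in 𝓝 (1 : 𝔸), DifferentiableAt ℝ localLog y := by
  filter_upwards [(contDiffAt_localLog (𝔸 := 𝔸) (m := 1)).eventually (by simp)] with y hy
  exact hy.differentiableAt one_ne_zero

/-! ### The trivialised differential of `exp` preserves an `Ad`-stable closed subspace -/

section dexp

variable {𝔤 : Submodule ℝ 𝔸}

omit [CompleteSpace 𝔸] in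
/-- Membership test through a continuous linear retraction `q : 𝔸 → 𝔤`: if `v - q v = 0` then
`v ∈ 𝔤`. [folklore] -/
theorem mem_of_sub_retraction_eq_zero (q : 𝔸 →L[ℝ] 𝔤) {v : 𝔸}
    (h : v - (𝔤.subtypeL.comp q) v = 0) : v ∈ 𝔤 := by
  rw [sub_eq_zero] at h
  rw [h]
  exact (q v).2

omit [CompleteSpace 𝔸] in
/-- For a retraction `q` (`q x = x` on `𝔤`), `v - q v = 0` for `v ∈ 𝔤`. [folklore] -/
theorem sub_retraction_eq_zero_of_mem {q : 𝔸 →L[ℝ] 𝔤} (hq : ∀ x : 𝔤, q x = x) {v : 𝔸}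
    (hv : v ∈ 𝔤) : v - (𝔤.subtypeL.comp q) v = 0 := by
  have := hq ⟨v, hv⟩
  rw [sub_eq_zero, ContinuousLinearMap.comp_apply, Submodule.subtypeL_apply, this]

/-- **The trivialised differential of `exp` preserves `𝔤`.** Let `𝔤` be a complemented closed
subspace of a real Banach algebra `𝔸` which is stable under `Ad (exp c)` for all `c ∈ 𝔤`. Then for
`c, Z ∈ 𝔤` the vector `exp (-c) · D exp (c)[Z]` lies in `𝔤` (it equals
`∫₀¹ Ad(exp (-s c)) Z ds = ∑ (-1)^m (ad c)^m Z / (m+1)!`). Proof without power series: for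
`F(s) = exp (-s c) · ∂_ε|₀ exp (s (c + ε Z))` one has `F(0) = 0` and, by the symmetry of second
derivatives and `d/ds exp (s W) = W exp (s W)`, `F'(s) = exp (-s c) Z exp (s c) ∈ 𝔤`; hence
`F(1) ∈ 𝔤`. Hilgert–Neeb, *Structure and Geometry of Lie Groups* (2012), Prop. 9.2.29 context;
Hall, *Lie Groups, Lie Algebras, and Representations* (2015), Thm. 5.3. [folklore] -/
theorem exp_neg_mul_fderiv_exp_mem (h𝔤 : 𝔤.ClosedComplemented)
    (hAd : ∀ c ∈ 𝔤, ∀ Z ∈ 𝔤, exp c * Z * exp (-c) ∈ 𝔤) {c Z : 𝔸} (hc : c ∈ 𝔤) (hZ : Z ∈ 𝔤) :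
    exp (-c) * fderiv ℝ exp c Z ∈ 𝔤 := by
  obtain ⟨q, hq⟩ := h𝔤
  -- the two-variable family `E (s, ε) = exp (s • (c + ε • Z))` and its derivative
  set E : ℝ × ℝ → 𝔸 := fun p => exp (p.1 • (c + p.2 • Z)) with hE
  have hEs : ContDiff ℝ ∞ E :=
    contDiff_exp.comp (contDiff_fst.smul (contDiff_const.add (contDiff_snd.smul contDiff_const)))
  set E' : ℝ × ℝ → ℝ × ℝ →L[ℝ] 𝔸 := fderiv ℝ E with hE'
  have hE's : ContDiff ℝ ∞ E' := hEs.fderiv_right le_rfl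
  have hEd : ∀ p, HasFDerivAt E (E' p) p := fun p =>
    (hEs.differentiable (by simp) p).hasFDerivAt
  have hE'd : ∀ p, HasFDerivAt E' (fderiv ℝ E' p) p := fun p =>
    (hE's.differentiable (by simp) p).hasFDerivAt
  -- partial derivatives along the two axes, as one-variable derivatives
  have hE_s : ∀ s ε : ℝ, HasDerivAt (fun r : ℝ => E (r, ε)) (E' (s, ε) (1, 0)) s := fun s ε => by
    exact (hEd (s, ε)).comp_hasDerivAt s ((hasDerivAt_id s).prodMk (hasDerivAt_const s ε))
  have hE_ε : ∀ s ε : ℝ, HasDerivAt (fun r : ℝ => E (s, r)) (E' (s, ε) (0, 1)) ε := fun s ε => by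
    exact (hEd (s, ε)).comp_hasDerivAt ε ((hasDerivAt_const ε s).prodMk (hasDerivAt_id ε))
  have hE'_s : ∀ s ε : ℝ, HasDerivAt (fun r : ℝ => E' (r, ε)) (fderiv ℝ E' (s, ε) (1, 0)) s :=
    fun s ε => by
    exact (hE'd (s, ε)).comp_hasDerivAt s ((hasDerivAt_id s).prodMk (hasDerivAt_const s ε))
  have hE'_ε : ∀ s ε : ℝ, HasDerivAt (fun r : ℝ => E' (s, r)) (fderiv ℝ E' (s, ε) (0, 1)) ε :=
    fun s ε => by
    exact (hE'd (s, ε)).comp_hasDerivAt ε ((hasDerivAt_const ε s).prodMk (hasDerivAt_id ε))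
  -- `∂_s E (s, ε) = (c + ε • Z) * E (s, ε)`
  have h1 : ∀ s ε : ℝ, E' (s, ε) (1, 0) = (c + ε • Z) * E (s, ε) := fun s ε =>
    (hE_s s ε).unique (by simpa [hE] using hasDerivAt_exp_smul_const' (𝕂 := ℝ) (c + ε • Z) s)
  -- `E (s, 0) = exp (s • c)`, `∂_ε E (0, 0) = 0`, `∂_ε E (1, 0) = D exp (c) Z`
  have hE0 : ∀ s : ℝ, E (s, 0) = exp (s • c) := fun s => by simp [hE]
  have hg0 : E' (0, 0) (0, 1) = 0 := by
    refine (hE_ε 0 0).unique ?_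
    have : (fun r : ℝ => E (0, r)) = fun _ => 1 := by funext r; simp [hE]
    rw [this]
    exact hasDerivAt_const _ _
  have hg1 : E' (1, 0) (0, 1) = fderiv ℝ exp c Z := by
    refine (hE_ε 1 0).unique ?_
    have hfun : (fun r : ℝ => E (1, r)) = fun r => exp (c + r • Z) := by funext r; simp [hE]
    rw [hfun]
    have hlin : HasDerivAt (fun r : ℝ => c + r • Z) Z 0 := by
      simpa using ((hasDerivAt_id (0 : ℝ)).smul_const Z).const_add c
    have hexp : HasFDerivAt exp (fderiv ℝ exp c) (c + (0 : ℝ) • Z) := by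
      rw [zero_smul, add_zero]
      exact ((contDiff_exp (m := 1)).differentiable one_ne_zero c).hasFDerivAt
    exact hexp.comp_hasDerivAt (0 : ℝ) hlin
  -- the derivative of `g s = ∂_ε E (s, 0)`: `g' = Z exp (s c) + c g`
  have h2 : ∀ s : ℝ, HasDerivAt (fun r : ℝ => E' (r, 0) (0, 1))
      (Z * exp (s • c) + c * E' (s, 0) (0, 1)) s := fun s => by
    have ha : HasDerivAt (fun r : ℝ => E' (r, 0) (0, 1)) (fderiv ℝ E' (s, 0) (1, 0) (0, 1)) s := by
      simpa using (hE'_s s 0).clm_apply (hasDerivAt_const s ((0 : ℝ), (1 : ℝ)))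
    have hsymm : fderiv ℝ E' (s, 0) (1, 0) (0, 1) = fderiv ℝ E' (s, 0) (0, 1) (1, 0) := by
      have h2 : (2 : WithTop ℕ∞) ≤ ∞ := ENat.natCast_le_of_coe_top_le_withTop le_rfl 2
      exact (hEs.contDiffAt.isSymmSndFDerivAt (n := ∞) (by simpa using h2)) (1, 0) (0, 1)
    -- the other mixed partial, computed from `h1`
    have hb : HasDerivAt (fun r : ℝ => E' (s, r) (1, 0)) (fderiv ℝ E' (s, 0) (0, 1) (1, 0)) 0 := by
      simpa using (hE'_ε s 0).clm_apply (hasDerivAt_const (0 : ℝ) ((1 : ℝ), (0 : ℝ)))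
    have hb' : HasDerivAt (fun r : ℝ => E' (s, r) (1, 0))
        (Z * E (s, 0) + (c + (0 : ℝ) • Z) * E' (s, 0) (0, 1)) 0 := by
      have hlin : HasDerivAt (fun r : ℝ => c + r • Z) Z 0 := by
        simpa using ((hasDerivAt_id (0 : ℝ)).smul_const Z).const_add c
      have h := hlin.mul (hE_ε s 0)
      simp_rw [h1]
      exact h
    have hmixed := hb.unique hb'
    rw [hsymm, hmixed, hE0, zero_smul, add_zero] at ha
    exact ha
  -- `F s = exp (s • (-c)) * g s` has derivative `exp (s • (-c)) * Z * exp (s • c) ∈ 𝔤`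
  set F : ℝ → 𝔸 := fun s => exp (s • (-c)) * E' (s, 0) (0, 1) with hF
  have hFd : ∀ s : ℝ, HasDerivAt F (exp (s • (-c)) * Z * exp (s • c)) s := fun s => by
    have h : HasDerivAt F (exp (s • (-c)) * (-c) * E' (s, 0) (0, 1) +
        exp (s • (-c)) * (Z * exp (s • c) + c * E' (s, 0) (0, 1))) s :=
      (hasDerivAt_exp_smul_const (𝕂 := ℝ) (-c) s).mul (h2 s)
    refine h.congr_deriv ?_
    noncomm_ring
  have hFmem : ∀ s : ℝ, exp (s • (-c)) * Z * exp (s • c) ∈ 𝔤 := fun s => by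
    have h := hAd (s • (-c)) (𝔤.smul_mem s (𝔤.neg_mem hc)) Z hZ
    rw [smul_neg, neg_neg] at h
    rwa [smul_neg]
  -- hence `R ∘ F` is constant, `R = id - q`
  set R : 𝔸 →L[ℝ] 𝔸 := ContinuousLinearMap.id ℝ 𝔸 - 𝔤.subtypeL.comp q with hR
  have hRF : ∀ s : ℝ, HasDerivAt (fun r => R (F r)) 0 s := fun s => by
    have h := R.hasFDerivAt.comp_hasDerivAt s (hFd s)
    have h0 : R (exp (s • (-c)) * Z * exp (s • c)) = 0 :=
      sub_retraction_eq_zero_of_mem hq (hFmem s)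
    rwa [h0] at h
  have hconst : R (F 1) = R (F 0) := is_const_of_deriv_eq_zero (fun s => (hRF s).differentiableAt)
    (fun s => (hRF s).deriv) 1 0
  have hF0 : F 0 = 0 := by simp [hF, hg0]
  have hF1 : F 1 = exp (-c) * fderiv ℝ exp c Z := by simp [hF, hg1]
  rw [hF0, map_zero, hF1] at hconst
  exact mem_of_sub_retraction_eq_zero q hconst

end dexp

/-! ### Paths with logarithmic derivative in `𝔤` have logarithm in `𝔤` -/

section Path

variable {𝔤 : Submodule ℝ 𝔸}

/-- **Local exponential coordinates for an `Ad`-stable subalgebra (path form).** Let `𝔤` be a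
complemented closed subspace of the real Banach algebra `𝔸`, stable under `Ad (exp c)` for
`c ∈ 𝔤`. There is an open neighbourhood `V` of `1`, on which `log = localLog` inverts `exp`, such
that every `C¹` path `γ : [0, 1] → V` with `γ 0 = 1` whose logarithmic derivative
`γ⁻¹ γ' = ξ` is bounded and takes values in `𝔤` satisfies `log γ(s) ∈ 𝔤` for all `s ∈ [0, 1]`
(so `γ(s) = exp (a(s))` with `a(s) ∈ 𝔤` small). Proof: `a = log ∘ γ` solves
`exp(-a) D exp(a)[a'] = ξ`; writing `a = q a + b` with `q` a retraction onto `𝔤`,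
`exp_neg_mul_fderiv_exp_mem` and the Lipschitz continuity of `x ↦ exp(-x) D exp(x)` give
`‖b'‖ ≤ K ‖b‖`, `b(0) = 0`, whence `b = 0` by Grönwall's inequality. This is the analytic core
of "the subgroup generated by `exp 𝔤` is a Lie subgroup with Lie algebra `𝔤`"
(Hilgert–Neeb, *Structure and Geometry of Lie Groups* (2012), §9.3–9.4; Hall, *Lie Groups, Lie
Algebras, and Representations* (2015), Thm. 5.20), here without the Baker–Campbell–Hausdorff
series. [folklore] -/
theorem exists_isOpen_forall_localLog_mem (h𝔤 : 𝔤.ClosedComplemented)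
    (hAd : ∀ c ∈ 𝔤, ∀ Z ∈ 𝔤, exp c * Z * exp (-c) ∈ 𝔤) :
    ∃ V : Set 𝔸, IsOpen V ∧ (1 : 𝔸) ∈ V ∧ (∀ y ∈ V, exp (localLog y) = y) ∧
      ∀ (γ ξ : ℝ → 𝔸) (B : ℝ), γ 0 = 1 → (∀ s ∈ Icc (0 : ℝ) 1, γ s ∈ V) →
        (∀ s ∈ Icc (0 : ℝ) 1, HasDerivAt γ (γ s * ξ s) s) → (∀ s ∈ Icc (0 : ℝ) 1, ξ s ∈ 𝔤) →
        (∀ s ∈ Icc (0 : ℝ) 1, ‖ξ s‖ ≤ B) → ∀ s ∈ Icc (0 : ℝ) 1, localLog (γ s) ∈ 𝔤 := by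
  obtain ⟨q, hq⟩ := h𝔤
  -- the retraction `Q` onto `𝔤` and the complementary projection `R = 1 - Q` (kernel `𝔤`)
  set Q : 𝔸 →L[ℝ] 𝔸 := 𝔤.subtypeL.comp q with hQ
  set R : 𝔸 →L[ℝ] 𝔸 := ContinuousLinearMap.id ℝ 𝔸 - Q with hR
  have hRapply : ∀ v, R v = v - Q v := fun v => rfl
  have hQR : ∀ v, Q v + R v = v := fun v => by rw [hRapply, add_sub_cancel]
  have hRmem : ∀ v ∈ 𝔤, R v = 0 := fun v hv => sub_retraction_eq_zero_of_mem hq hv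
  have hQmem : ∀ v, Q v ∈ 𝔤 := fun v => (q v).2
  have hRR : ∀ v, R (R v) = R v := fun v => by
    conv_lhs => rw [hRapply v]
    rw [map_sub, hRmem _ (hQmem v), sub_zero]
  -- the trivialised differential `T a = exp (-a) · D exp (a)`, a `C¹` map into operators
  set T : 𝔸 → 𝔸 →L[ℝ] 𝔸 := fun a =>
    (ContinuousLinearMap.mul ℝ 𝔸 (exp (-a))).comp (fderiv ℝ exp a) with hT
  have hTapply : ∀ a v, T a v = exp (-a) * fderiv ℝ exp a v := fun a v => rfl
  have hTs : ContDiff ℝ 1 T :=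
    ((ContinuousLinearMap.mul ℝ 𝔸).contDiff.comp (contDiff_exp.comp contDiff_neg)).clm_comp
      ((contDiff_exp (m := 1 + 1)).fderiv_right le_rfl)
  have hT0 : T 0 = 1 := by
    ext v
    simp [hTapply, fderiv_exp_zero]
  have hTmem : ∀ κ ∈ 𝔤, ∀ v ∈ 𝔤, T κ v ∈ 𝔤 := fun κ hκ v hv => by
    rw [hTapply]
    exact exp_neg_mul_fderiv_exp_mem ⟨q, hq⟩ hAd hκ hv
  -- a Lipschitz neighbourhood of `T` at `0`, on which moreover `‖T a - 1‖ < η`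
  obtain ⟨K, t, ht, hKt⟩ := hTs.contDiffAt.exists_lipschitzOnWith (x := (0 : 𝔸))
  obtain ⟨ε₁, hε₁, hball₁⟩ := Metric.mem_nhds_iff.1 ht
  set η : ℝ := 1 / (2 * (‖R‖ + 1)) with hη
  have hηpos : 0 < η := by positivity
  obtain ⟨ε₂, hε₂, hball₂⟩ := Metric.continuousAt_iff.1 (hTs.continuous.continuousAt (x := (0 : 𝔸)))
    η hηpos
  set δ : ℝ := min ε₁ ε₂ with hδ
  have hδpos : 0 < δ := lt_min hε₁ hε₂
  have hsmall : ∀ a : 𝔸, ‖a‖ < δ → a ∈ t ∧ ‖T a - 1‖ < η := fun a hlt => by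
    refine ⟨hball₁ (Metric.mem_ball.2 ?_), ?_⟩
    · rw [dist_zero_right]
      exact hlt.trans_le (min_le_left _ _)
    · have h := hball₂ (x := a) (by rw [dist_zero_right]; exact hlt.trans_le (min_le_right _ _))
      rwa [dist_eq_norm, hT0] at h
  -- the neighbourhood `V` of `1`
  set δ' : ℝ := δ / (‖Q‖ + 1) with hδ'
  have hδ'pos : 0 < δ' := by positivity
  have hδ'le : δ' ≤ δ := div_le_self hδpos.le (by linarith [norm_nonneg Q])
  have hV : ∀ᶠ y in 𝓝 (1 : 𝔸),
      exp (localLog y) = y ∧ DifferentiableAt ℝ localLog y ∧ ‖localLog y‖ < δ' := by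
    refine eventually_exp_localLog.and (eventually_differentiableAt_localLog.and ?_)
    have hc : ContinuousAt localLog (1 : 𝔸) := (contDiffAt_localLog (m := 0)).continuousAt
    have hpre : localLog ⁻¹' Metric.ball 0 δ' ∈ 𝓝 (1 : 𝔸) :=
      hc.preimage_mem_nhds (by rw [localLog_one]; exact Metric.ball_mem_nhds _ hδ'pos)
    filter_upwards [hpre] with y hy
    simpa using hy
  obtain ⟨V, hVprop, hVopen, hV1⟩ := eventually_nhds_iff.1 hV
  refine ⟨V, hVopen, hV1, fun y hy => (hVprop y hy).1, ?_⟩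
  -- the path argument
  intro γ ξ B hγ0 hγV hγd hξ hξB
  set a : ℝ → 𝔸 := fun r => localLog (γ r) with ha
  set a' : ℝ → 𝔸 := fun r => fderiv ℝ localLog (γ r) (γ r * ξ r) with ha'
  have had : ∀ r ∈ Icc (0 : ℝ) 1, HasDerivAt a (a' r) r := fun r hr =>
    (hVprop _ (hγV r hr)).2.1.hasFDerivAt.comp_hasDerivAt r (hγd r hr)
  have hexpa : ∀ r ∈ Icc (0 : ℝ) 1, exp (a r) = γ r := fun r hr => (hVprop _ (hγV r hr)).1
  -- `D exp (a) [a'] = γ ξ`, i.e. `T a a' = ξ`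
  have hkey : ∀ r ∈ Icc (0 : ℝ) 1, fderiv ℝ exp (a r) (a' r) = γ r * ξ r := fun r hr => by
    have h1 : HasDerivAt (fun r' => exp (a r')) (fderiv ℝ exp (a r) (a' r)) r :=
      ((contDiff_exp (m := 1)).differentiable one_ne_zero (a r)).hasFDerivAt.comp_hasDerivAt r
        (had r hr)
    have hev : ∀ᶠ r' in 𝓝 r, γ r' ∈ V :=
      (hγd r hr).continuousAt.preimage_mem_nhds (hVopen.mem_nhds (hγV r hr))
    have h2 : HasDerivAt (fun r' => exp (a r')) (γ r * ξ r) r := by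
      refine (hγd r hr).congr_of_eventuallyEq ?_
      filter_upwards [hev] with r' hr'
      exact (hVprop _ hr').1
    exact h1.unique h2
  have hTa : ∀ r ∈ Icc (0 : ℝ) 1, T (a r) (a' r) = ξ r := fun r hr => by
    rw [hTapply, hkey r hr, ← mul_assoc, ← hexpa r hr, exp_neg_mul_exp, one_mul]
  -- smallness along the path
  have ha_small : ∀ r ∈ Icc (0 : ℝ) 1, ‖a r‖ < δ' := fun r hr => (hVprop _ (hγV r hr)).2.2
  have ha_t : ∀ r ∈ Icc (0 : ℝ) 1, a r ∈ t ∧ ‖T (a r) - 1‖ < η := fun r hr =>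
    hsmall _ ((ha_small r hr).trans_le hδ'le)
  have hc_small : ∀ r ∈ Icc (0 : ℝ) 1, ‖Q (a r)‖ < δ := fun r hr => by
    calc ‖Q (a r)‖ ≤ ‖Q‖ * ‖a r‖ := Q.le_opNorm _
      _ ≤ (‖Q‖ + 1) * ‖a r‖ := by gcongr; linarith
      _ < (‖Q‖ + 1) * δ' := mul_lt_mul_of_pos_left (ha_small r hr) (by positivity)
      _ = δ := by rw [hδ']; field_simp
  have hc_t : ∀ r ∈ Icc (0 : ℝ) 1, Q (a r) ∈ t := fun r hr => (hsmall _ (hc_small r hr)).1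
  -- `‖a'‖ ≤ 2 B`
  have hη_half : η ≤ 1 / 2 := by
    rw [hη]
    gcongr
    linarith [norm_nonneg R]
  have ha'_bound : ∀ r ∈ Icc (0 : ℝ) 1, ‖a' r‖ ≤ 2 * B := fun r hr => by
    have h1 : a' r = T (a r) (a' r) - (T (a r) - 1) (a' r) := by simp
    have h2 : ‖(T (a r) - 1) (a' r)‖ ≤ η * ‖a' r‖ :=
      ((T (a r) - 1).le_opNorm _).trans (by gcongr; exact (ha_t r hr).2.le)
    have h3 : ‖a' r‖ ≤ ‖ξ r‖ + η * ‖a' r‖ := by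
      calc ‖a' r‖ = ‖T (a r) (a' r) - (T (a r) - 1) (a' r)‖ := by rw [← h1]
        _ ≤ ‖T (a r) (a' r)‖ + ‖(T (a r) - 1) (a' r)‖ := norm_sub_le _ _
        _ ≤ ‖ξ r‖ + η * ‖a' r‖ := by rw [hTa r hr]; gcongr
    nlinarith [hξB r hr, norm_nonneg (a' r)]
  -- the differential inequality `‖(R a)'‖ ≤ C ‖R a‖`
  have hRη : ‖R‖ * η ≤ 1 / 2 := by
    rw [hη, mul_one_div, div_le_div_iff₀ (by positivity) (by norm_num)]
    nlinarith [norm_nonneg R]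
  have hest : ∀ r ∈ Icc (0 : ℝ) 1,
      ‖R (a' r)‖ ≤ (2 * ‖R‖ * K * ‖Q‖ * (2 * B)) * ‖R (a r)‖ := fun r hr => by
    have e1 : R (T (a r) (a' r)) = 0 := hRmem _ (by rw [hTa r hr]; exact hξ r hr)
    have e2 : R (T (Q (a r)) (Q (a' r))) = 0 :=
      hRmem _ (hTmem _ (hQmem (a r)) _ (hQmem (a' r)))
    have e3 : T (a r) (a' r) = T (a r) (Q (a' r)) + T (a r) (R (a' r)) := by
      conv_lhs => rw [← hQR (a' r)]
      rw [map_add]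
    have s3 : R (T (a r) (Q (a' r))) + R (T (a r) (R (a' r))) = 0 := by
      rw [← map_add, ← e3]
      exact e1
    have e4 : R (a' r) =
        -(R ((T (a r) - T (Q (a r))) (Q (a' r)))) - R ((T (a r) - 1) (R (a' r))) := by
      simp only [sub_apply, one_apply_eq_self, map_sub]
      rw [e2, hRR, eq_neg_of_add_eq_zero_left s3]
      abel
    have n1 : ‖R ((T (a r) - T (Q (a r))) (Q (a' r)))‖ ≤
        ‖R‖ * ((K * ‖R (a r)‖) * (‖Q‖ * (2 * B))) := by
      calc ‖R ((T (a r) - T (Q (a r))) (Q (a' r)))‖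
          ≤ ‖R‖ * ‖(T (a r) - T (Q (a r))) (Q (a' r))‖ := R.le_opNorm _
        _ ≤ ‖R‖ * (‖T (a r) - T (Q (a r))‖ * ‖Q (a' r)‖) := by
          gcongr
          exact (T (a r) - T (Q (a r))).le_opNorm _
        _ ≤ ‖R‖ * ((K * ‖a r - Q (a r)‖) * (‖Q‖ * ‖a' r‖)) := by
          gcongr
          · exact lipschitzOnWith_iff_norm_sub_le.1 hKt (ha_t r hr).1 (hc_t r hr)
          · exact Q.le_opNorm _
        _ ≤ ‖R‖ * ((K * ‖R (a r)‖) * (‖Q‖ * (2 * B))) := by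
          rw [← hRapply]
          gcongr
          exact ha'_bound r hr
    have n2 : ‖R ((T (a r) - 1) (R (a' r)))‖ ≤ ‖R‖ * (η * ‖R (a' r)‖) := by
      calc ‖R ((T (a r) - 1) (R (a' r)))‖ ≤ ‖R‖ * ‖(T (a r) - 1) (R (a' r))‖ := R.le_opNorm _
        _ ≤ ‖R‖ * (‖T (a r) - 1‖ * ‖R (a' r)‖) := by
          gcongr
          exact (T (a r) - 1).le_opNorm _
        _ ≤ ‖R‖ * (η * ‖R (a' r)‖) := by
          gcongr
          exact (ha_t r hr).2.le
    have main : ‖R (a' r)‖ ≤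
        ‖R‖ * ((K * ‖R (a r)‖) * (‖Q‖ * (2 * B))) + ‖R‖ * (η * ‖R (a' r)‖) := by
      calc ‖R (a' r)‖
          = ‖-(R ((T (a r) - T (Q (a r))) (Q (a' r)))) - R ((T (a r) - 1) (R (a' r)))‖ := by
            rw [← e4]
        _ ≤ ‖-(R ((T (a r) - T (Q (a r))) (Q (a' r))))‖ + ‖R ((T (a r) - 1) (R (a' r)))‖ :=
            norm_sub_le _ _
        _ ≤ _ := by
            rw [norm_neg]
            exact add_le_add n1 n2
    have h4 : ‖R‖ * (η * ‖R (a' r)‖) ≤ (1 / 2) * ‖R (a' r)‖ := by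
      rw [← mul_assoc]
      exact mul_le_mul_of_nonneg_right hRη (norm_nonneg _)
    nlinarith [norm_nonneg (R (a' r)), norm_nonneg (R (a r)), norm_nonneg R, norm_nonneg Q,
      NNReal.coe_nonneg K]
  -- Grönwall: `R ∘ a = 0` on `[0, 1]`
  have hb_cont : ContinuousOn (fun r => R (a r)) (Icc 0 1) := fun r hr =>
    (R.continuous.continuousAt.comp (had r hr).continuousAt).continuousWithinAt
  have hb_deriv : ∀ r ∈ Ico (0 : ℝ) 1,
      HasDerivWithinAt (fun r => R (a r)) (R (a' r)) (Ici r) r := fun r hr =>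
    (R.hasFDerivAt.comp_hasDerivAt r (had r (Ico_subset_Icc_self hr))).hasDerivWithinAt
  have hb0 : R (a 0) = 0 := by
    simp [ha, hγ0, localLog_one]
  have hb_zero := eq_zero_of_abs_deriv_le_mul_abs_self_of_eq_zero_right hb_cont hb_deriv hb0
    fun r hr => hest r (Ico_subset_Icc_self hr)
  intro s hs
  have h := hQR (a s)
  rw [hb_zero s hs, add_zero] at h
  rw [show localLog (γ s) = a s from rfl, ← h]
  exact hQmem _

end Path

end Literature.Analysis.Calculus
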